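import Literature.MathematicalPhysics.QuantumFieldTheory.Balaban1983to89.Node00.LocalGaugeCoDivergenceLetters
import Literature.MathematicalPhysics.QuantumFieldTheory.Balaban1983to89.B7TransferAnalyticMean
import HarnessLib

/-!
# N07 [B11] (= [15] = [Balaban1985Variational]) Sect. F, road of record R0′, WIDTH-209 row (r2), FILE 13: **THE LANDAU PER-BOND LETTER `θ` FROM S3's (152) GAUGE EQUATION** —
# on every bond where `(ι∘U)^{ι∘u}(b) = e^{iξA(b)}` with `‖A(b)‖ < t` and `ξt ≤ 1`, the Landau copy `U₁ := U^u` has `dist1 U₁(b) ≤ 2ξt` (FILE 12's `hU₁` with `θ := 2ξt`)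

Cell `pub-ymgap`, width seat `pub-ymgap-dag-n07-w8` g5, WIDTH-209 N07 row (r2) of road R0′, CLAIM-13 ∕ INTENT-13 (cell bus; own lineage FILE 12 → FILE 13).
`--kind proof --supports stmt-QuantumFields-27364 --as helper` (K1⁹ per dag-lead KEY MAP v2 ∕ GATE v1.69); count-neutral; def-free.
[15] = [Balaban1985Variational] (152) p. 301; [6] = [Balaban1985RegularSpaces] Thm 2; [12] = [Balaban1987RG1] (1.10)–(1.13) p. 262; [3] = [Balaban1985Averaging] (8) p. 19.

THE POINT.  FILE 12 `N07FineBoxShearVariation.fineVariation_le_of_runSums` displays the Landau side of the shear's variation as a per-bond letter `dist1 U₁(b) ≤ θ` on the box bonds.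
At the record `U₁ = U^u` is [6] Thm 2's Landau copy delivered by S3 with the (152) gauge equation `(ι∘U)^{ι∘u}(b) = e^{iξA(b)}`, `ξ = η_{K−n} = L^{−(K−n)}`, and the UNWEIGHTED letter
`‖A(b)‖ < t` on the window's bonds (`Sect2.LocalGaugeOn` ∕ the head's `he`, `hA`); then `dist1 U^u(b) = ‖e^{iξA(b)} − 1‖ ≤ 2ξ‖A(b)‖ ≤ 2ξt` once `ξt ≤ 1` — the letter `θ := 2ξt`, of
order `L^{−(K−n)}·t`, so that FILE 12's `D_κ·θ ≲ d(M + 4ρ + 3)·2t` is UNIFORM in the height (`η·L^{K−n} = 1`).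

WHAT IS PROVED (sorry-free; no definition; axioms standard).
* ★ `dist1_gaugeAct_le_of_gaugeU_expI` — one bond: `gaugeU (ι∘u) (ι∘U) b = expI ξ (A b)`, `0 ≤ ξ`, `ξ‖A b‖ ≤ 1` ⇒ `dist1 (U^u b) ≤ 2ξ‖A b‖` (n07-e `Node00.ιSU_gaugeAct`,
  `Node00.coe_ιSU`, lit `B7TransferAnalyticMean.norm_exp_sub_one_le_two_mul`).
* ★★ `dist1_gaugeAct_le_of_gauge152` — on a bond set `B` where the gauge equation and `‖A b‖ < t` hold, `ξt ≤ 1`: `∀ b ∈ B, dist1 (U^u b) ≤ 2ξt` (FILE 12's `hU₁` for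
  `U₁ := U^u` once the box bonds lie in `B`).
* A6 `dist1_gaugeAct_le_of_gauge152_zero` — at `A = 0`, `u = 1`, `U = 1` the gauge equation holds (`e^{0} = 1`) and the letter is met with `t` arbitrary positive.
HONEST SCOPE.  Count-neutral matrix-exponential bookkeeping; S3's gauge `(u, A)` and its letters are HYPOTHESES ([6] Thm 2 ∕ [B8] Prop 6 = N05's in-edge); nothing of [15]∕[6]
ANALYSIS asserted; `LocalLettersSplitTopStepCore(G∕R)` ∕ `DatumGaugeSplitTopStepCore(G∕R)` ∕ `HalvingStepTop(Core)` ∕ `stub_prop8StepCoP13` NOT discharged; K0⁷ ∕ K1⁹ NOT closed; N07 NOT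
discharged; counts unmoved (typed 28∕28 · discharged 5∕27); one finite 𝕋⁴ programme at fixed ε — the route closes the conditional finite-𝕋⁴ rung `BalabanLadder.UV` ONLY; the YM mass gap
(Clay) is NOT proved by any of this; nothing continuum ∕ ℝ⁴ ∕ OS.  No `sorry`, no `def`, no `instance`, no `notation`.

RELATED IN THE TREE, NOT DUPLICATED (stem check 2026-08-28T13:00Z: `ls …/Theorems | rg -i 'LandauBond|BondLetter152'` = ∅): k0-s1 `K0VariationalThm1GaugeWrap.norm_expI_sub_one_le`
(the same exponential step inside a K0 wrap file with a heavy import closure — re-derived here as a `have`, three lines, rather than imported); n07-e module 32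
`Node00.LocalGaugeCoDivergenceLetters` (plaquette ∕ co-divergence letters under the same gauge equation — the bond letter is the zeroth member, not stated there).
-/

set_option autoImplicit false

noncomputable section
open scoped Matrix.Norms.L2Operator

namespace Summit.QuantumFields.YangMills.BalabanUVNodes.N07LandauBondLetter

open Literature.MathematicalPhysics.QuantumFieldTheory.Balaban1983to89
open Literature.MathematicalPhysics.QuantumFieldTheory.Balaban1983to89.Node00
open Literature.MathematicalPhysics.QuantumFieldTheory.Balaban1983to89.B12RegularSpaces111 (gaugeU expI)
open GaugeField (gaugeAct)

variable {P : Params} (N : ℕ) [NeZero N]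

/-- ★ **ONE BOND**: if the embedded gauge-transformed bond variable satisfies the (152)∕(1.13) gauge equation `(ι∘U)^{ι∘u}(b) = e^{iξA(b)}` with `0 ≤ ξ` and `ξ‖A(b)‖ ≤ 1`, then
`dist1 (U^u(b)) ≤ 2ξ‖A(b)‖` (`dist1 = ‖· − 1‖_op` on `SU(N)`; `‖e^Y − 1‖ ≤ 2‖Y‖` for `‖Y‖ ≤ 1`).
[cite: Balaban1985Variational, (152) p.301; Balaban1987RG1, (1.13) p.262; Balaban1985Averaging, (8) p.19] -/
theorem dist1_gaugeAct_le_of_gaugeU_expI (u : GaugeTransf P 0 (SU N)) (U : GaugeField P 0 (SU N)) (b : PBond P 0) {ξ : ℝ} (hξ : 0 ≤ ξ) {A : PBond P 0 → MatA N}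
    (he : gaugeU (fun x => ιSU N (u x)) (fun b' => ιSU N (U b')) b = expI ξ (A b)) (hA : ξ * ‖A b‖ ≤ 1) :
    dist1 (gaugeAct u U b) ≤ 2 * (ξ * ‖A b‖) := by
  -- the `SU(N)` distance is the matrix distance of the embedded variable
  have h1 : dist1 (gaugeAct u U b) = ‖((ιSU N (gaugeAct u U b) : (MatA N)ˣ) : MatA N) - 1‖ := by rw [coe_ιSU]; rfl
  rw [h1, ιSU_gaugeAct, he]
  -- `‖e^{iξA} − 1‖ ≤ 2ξ‖A‖`
  have hn : ‖(Complex.I * (ξ : ℂ)) • A b‖ = ξ * ‖A b‖ := by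
    rw [norm_smul, norm_mul, Complex.norm_I, one_mul, Complex.norm_real, Real.norm_of_nonneg hξ]
  show ‖NormedSpace.exp ((Complex.I * (ξ : ℂ)) • A b) - 1‖ ≤ _
  rw [← hn]
  exact B7TransferAnalyticMean.norm_exp_sub_one_le_two_mul (by rw [hn]; exact hA)

/-- ★★ **THE LANDAU PER-BOND LETTER ON A BOND SET**: if on every bond of `B` the gauge equation holds and `‖A(b)‖ < t` (S3's window letters `he`, `hA`), and `ξt ≤ 1`, then
`dist1 (U^u(b)) ≤ 2ξt` on `B` — FILE 12's `hU₁` with `U₁ := U^u` (the Landau copy) and `θ := 2ξt`, once the fine box's bonds lie in `B`.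
[cite: Balaban1985Variational, (152) p.301; Balaban1985RegularSpaces, Thm 2; Balaban1987RG1, (1.10)–(1.13) p.262] -/
theorem dist1_gaugeAct_le_of_gauge152 (u : GaugeTransf P 0 (SU N)) (U : GaugeField P 0 (SU N)) {ξ t : ℝ} (hξ : 0 ≤ ξ) (hξt : ξ * t ≤ 1)
    {A : PBond P 0 → MatA N} {B : Set (PBond P 0)}
    (he : ∀ b ∈ B, gaugeU (fun x => ιSU N (u x)) (fun b' => ιSU N (U b')) b = expI ξ (A b)) (hA : ∀ b ∈ B, ‖A b‖ < t) :
    ∀ b ∈ B, dist1 (gaugeAct u U b) ≤ 2 * (ξ * t) := by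
  intro b hb
  have hAb : ξ * ‖A b‖ ≤ ξ * t := mul_le_mul_of_nonneg_left (hA b hb).le hξ
  exact (dist1_gaugeAct_le_of_gaugeU_expI N u U b hξ (he b hb) (hAb.trans hξt)).trans (mul_le_mul_of_nonneg_left hAb (by norm_num))

/-- A6 NON-VACUITY: at the trivial data `u = 1`, `U = 1`, `A = 0` the gauge equation holds on every bond (`(ι1)·(ι1)·(ι1)⁻¹ = 1 = e^{0}`), `‖A b‖ = 0 < t` for any `t > 0`,
and the conclusion reads `dist1 1 ≤ 2ξt`. [cite: Balaban1985Variational, (152) p.301 (bookkeeping)] -/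
theorem dist1_gaugeAct_le_of_gauge152_zero {ξ t : ℝ} (hξ : 0 ≤ ξ) (ht : 0 < t) (hξt : ξ * t ≤ 1) (B : Set (PBond P 0)) :
    ∀ b ∈ B, dist1 (gaugeAct (fun _ : Site P 0 => (1 : SU N)) (fun _ : PBond P 0 => (1 : SU N)) b) ≤ 2 * (ξ * t) := by
  refine dist1_gaugeAct_le_of_gauge152 N (fun _ => 1) (fun _ => 1) hξ hξt (A := fun _ => 0) (fun b _ => ?_) (fun b _ => by simpa using ht)
  have h1 : gaugeU (fun x => ιSU N ((fun _ : Site P 0 => (1 : SU N)) x)) (fun b' => ιSU N ((fun _ : PBond P 0 => (1 : SU N)) b')) b = 1 := by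
    simp [gaugeU, map_one]
  rw [h1]
  -- `e^{iξ·0} = 1`
  apply Units.ext
  show (1 : MatA N) = ((expI ξ (0 : MatA N) : (MatA N)ˣ) : MatA N)
  simp [expI, Beta.BackgroundVertices.expUnit]

end Summit.QuantumFields.YangMills.BalabanUVNodes.N07LandauBondLetter

end
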